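import Literature.NumberTheory.EllipticCurves.ModularSymbolsPeriodHomology
import Literature.NumberTheory.EllipticCurves.ModularSymbolsProofs
import Literature.NumberTheory.EllipticCurves.CuspFormLFunctionFrickeProofs
import HarnessLib

/-!
# Crux Kan⁺ `ThetaLayerLambdaCongruenceAtTwo` (stmt-BirchSwinnertonDyer-20688), SD floor, sub-brick (W) of S6 —
# the Fricke involution `w_N` on the period homology `Λ = H₁(X₀(N), ℤ)`
# (width seat bsd-wall-rtt-p3-w4 g6; `--supports stmt-BirchSwinnertonDyer-20688`; THEOREMS ONLY, no `def`, no `sorry`;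
# BSD is not proved by any of this)

The Hecke-self-adjoint pairing on `Λ = periodHomology N` that the multiplicity-one dictionaries consume
(`periodHomology_exists_heckeSelfAdjoint_perfectPairing`) is the intersection form TWISTED BY `w_N`:
`B(x, y) = x • (w_N y)` (the transpose of `U_q` is `w_N U_q w_N`). Every assembly of it therefore needs the
Atkin–Lehner–Fricke involution acting ON `Λ`. This file proves, for weight `2` and every level `N ≥ 1`:

* `cuspSymbol_frickeInvolution`: **`{∞, γ∞}_{w_N h} = {∞, γ'∞}_h`** for `γ, γ' ∈ Γ₀(N)` with
  `w_N ∘ γ = γ' ∘ w_N` on `ℍ` (`γ' = w_N γ w_N⁻¹ = (d, -c/N; -Nb, a)`), i.e. the dual of `w_N` on `S₂(Γ₀(N))^∨`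
  carries the period functional of `γ` to that of its Fricke conjugate
  (`dualMap_frickeInvolution_periodFunctional`);
* `exists_frickeConj_smul`: such a `γ'` exists for every `γ` (the tree's `frickeGL_mul_mul_inv_mem`);
* `dualMap_frickeInvolution_mem_periodHomology`: **`w_N^∨(Λ) ⊆ Λ`**, and `w_N^∨ ∘ w_N^∨ = id` on `S₂^∨`
  (`dualMap_frickeInvolution_dualMap_frickeInvolution`), so `w_N^∨` is an involution OF `Λ`;
* `dualMap_frickeInvolution_dualMap_heckeT`: `w_N^∨ T_n^∨ = T_n^∨ w_N^∨` for `gcd(n, N) = 1` (dual of the tree's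
  `frickeInvolution_heckeT`).

PROOF (Manin's primitive argument, as in the tree's `verticalIntegral_smul_sub_eq`): with
`E_h(τ) = 2πi ∫_{i∞}^τ h` (`eichlerIntegral`), both `τ ↦ E_h(w_N τ)` and `τ ↦ E_{w_N h}(τ)` have derivative
`2πi h(w_N τ)·(Nτ²)⁻¹ = 2πi (w_N h)(τ)` on `ℍ` (`hasDerivAt_eichlerIntegral`, chain rule for `τ ↦ -1/(Nτ)`, and
the weight-`2` formula `(w_N h)(τ) = h(-1/(Nτ))/(Nτ²)` from `frickeInvolution_apply_eq_slash_holds`), so their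
difference is constant on the connected `ℍ`; hence
`{∞, γ∞}_{w_N h} = E_{w_N h}(γτ) - E_{w_N h}(τ) = E_h(w_N γ τ) - E_h(w_N τ) = E_h(γ' w_N τ) - E_h(w_N τ) = {∞, γ'∞}_h`
(`eichlerIntegral_smul_sub_holds`). No orientation, sign or normalisation subtlety survives: the scalar
`N^{1-k/2}` of `frickeInvolution` is `1` in weight `2`.

## References
* A. O. L. Atkin, J. Lehner, Hecke operators on `Γ₀(m)`, Math. Ann. 185 (1970), §2 and Lemma 7 [AtkinLehner1970].
* Ju. I. Manin, Parabolic points and zeta functions of modular curves (1972), Prop. 1.4 [Manin1972].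
* L. Merel, Homologie des courbes modulaires affines et paramétrisations modulaires (1995), §2.3 [Merel1995Homologie].
-/

-- justification: the `Summit.BirchSwinnertonDyer.BirchSwinnertonDyer.…` path repeats a component (route-file convention)
set_option linter.dupNamespace false
set_option autoImplicit false

noncomputable section

open scoped MatrixGroups ModularForm

open CongruenceSubgroup Matrix.SpecialLinearGroup ModularGroup UpperHalfPlane Complex

open Literature.NumberTheory.EllipticCurves Literature.NumberTheory.EllipticCurves.ModularForms

namespace Summit.BirchSwinnertonDyer.BirchSwinnertonDyer.Theorems.SdTorsion

variable {N : ℕ} [NeZero N]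

/-! ### The weight-`2` Fricke involution pointwise, and `w_N` on `ℍ` -/

/-- **`(w_N h)(τ) = h(w_N τ) · (Nτ²)⁻¹` in weight `2`** (`w_N τ = -1/(Nτ)`; the normalising scalar `N^{1-k/2}`
of `frickeInvolution` is `1` and Mathlib's `|det|^{k-1} = N`). [cite: AtkinLehner1970, §2] -/
theorem frickeInvolution_two_apply (h : CuspForm (Gamma0 N) 2) (τ : ℍ) :
    frickeInvolution N 2 h τ =
      h (glCast (frickeGL N : GL (Fin 2) ℚ) • τ) * (((N : ℂ) * (τ : ℂ) ^ 2)⁻¹) := by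
  have hN : (N : ℂ) ≠ 0 := by exact_mod_cast NeZero.ne N
  have hτ : (τ : ℂ) ≠ 0 := τ.ne_zero
  have hfun := frickeInvolution_apply_eq_slash_holds N 2 h
  have hpt := congr_fun hfun τ
  rw [hpt, Pi.smul_apply, smul_eq_mul, ModularForm.slash_apply, σ_glCast, det_glCast_frickeGL, denom,
    val_glCast_frickeGL]
  have hscal : (((N : ℝ) ^ (1 - ((2 : ℤ) : ℝ) / 2) : ℝ) : ℂ) = 1 := by
    norm_num
  rw [hscal]
  simp only [Matrix.of_apply, Matrix.cons_val', Matrix.cons_val_zero, Matrix.cons_val_one,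
    Matrix.cons_val_fin_one, Nat.abs_cast]
  push_cast
  field_simp
  ring

/-- `w_N τ` as a complex number: `-((N τ)⁻¹)`, restated for `ofComplex`: for `im z > 0`,
`w_N • ofComplex z = ofComplex (-(Nz)⁻¹)`. [folklore] -/
theorem frickeGL_smul_ofComplex {z : ℂ} (hz : 0 < z.im) :
    glCast (frickeGL N : GL (Fin 2) ℚ) • ofComplex z = ofComplex (-((N : ℂ) * z)⁻¹) := by
  have h1 : ((glCast (frickeGL N : GL (Fin 2) ℚ) • ofComplex z : ℍ) : ℂ) = -((N : ℂ) * z)⁻¹ := by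
    rw [coe_frickeGL_smul, ofComplex_apply_of_im_pos hz]
  have him : 0 < (-((N : ℂ) * z)⁻¹).im := by
    rw [← h1]
    exact (glCast (frickeGL N : GL (Fin 2) ℚ) • ofComplex z).im_pos
  exact UpperHalfPlane.ext (by rw [h1, ofComplex_apply_of_im_pos him])

/-- `im(-(Nz)⁻¹) > 0` for `im z > 0`. [folklore] -/
theorem im_fricke_pos {z : ℂ} (hz : 0 < z.im) : 0 < (-((N : ℂ) * z)⁻¹).im := by
  have h1 : ((glCast (frickeGL N : GL (Fin 2) ℚ) • ofComplex z : ℍ) : ℂ) = -((N : ℂ) * z)⁻¹ := by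
    rw [coe_frickeGL_smul, ofComplex_apply_of_im_pos hz]
  rw [← h1]
  exact (glCast (frickeGL N : GL (Fin 2) ℚ) • ofComplex z).im_pos

/-! ### The primitive argument: `E_h(w_N τ) - E_{w_N h}(τ)` is constant on `ℍ` -/

/-- **`τ ↦ E_h(w_N τ) - E_{w_N h}(τ)` has derivative `0` on `ℍ`**: both terms have derivative
`2πi h(w_N τ)·(Nτ²)⁻¹` (`hasDerivAt_eichlerIntegral`, the chain rule for `τ ↦ -1/(Nτ)`, and
`frickeInvolution_two_apply`). [cite: Manin1972, Prop. 1.4] -/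
theorem hasDerivAt_eichlerIntegral_fricke_sub (h : CuspForm (Gamma0 N) 2) {z : ℂ} (hz : 0 < z.im) :
    HasDerivAt (fun w : ℂ ↦ eichlerIntegral h (ofComplex (-((N : ℂ) * w)⁻¹)) -
      eichlerIntegral (frickeInvolution N 2 h) (ofComplex w)) 0 z := by
  have hN : (N : ℂ) ≠ 0 := by exact_mod_cast NeZero.ne N
  have hz0 : z ≠ 0 := by
    rintro rfl
    simp at hz
  -- the Möbius map `w ↦ -(Nw)⁻¹` and its derivative `(Nz²)⁻¹`
  have hm : HasDerivAt (fun w : ℂ ↦ -((N : ℂ) * w)⁻¹) (((N : ℂ) * z ^ 2)⁻¹) z := by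
    have h1 : HasDerivAt (fun w : ℂ ↦ (N : ℂ) * w) (N : ℂ) z := by
      simpa using (hasDerivAt_id z).const_mul (N : ℂ)
    have h2 := (h1.inv (mul_ne_zero hN hz0)).neg
    refine h2.congr_deriv ?_
    have hNz2 : (N : ℂ) * z ^ 2 ≠ 0 := mul_ne_zero hN (pow_ne_zero 2 hz0)
    rw [neg_div, neg_neg, div_eq_iff (pow_ne_zero 2 (mul_ne_zero hN hz0)), mul_pow,
      show (N : ℂ) ^ 2 * z ^ 2 = ((N : ℂ) * z ^ 2) * N by ring, ← mul_assoc, inv_mul_cancel₀ hNz2, one_mul]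
  have h1 := (hasDerivAt_eichlerIntegral h (im_fricke_pos (N := N) hz)).comp z hm
  have h2 := hasDerivAt_eichlerIntegral (frickeInvolution N 2 h) hz
  refine (h1.sub h2).congr_deriv ?_
  rw [frickeInvolution_two_apply, frickeGL_smul_ofComplex hz, ofComplex_apply_of_im_pos hz]
  change 2 * ↑Real.pi * Complex.I * h (ofComplex (-((N : ℂ) * z)⁻¹)) * ((N : ℂ) * z ^ 2)⁻¹ -
      2 * ↑Real.pi * Complex.I * (h (ofComplex (-((N : ℂ) * z)⁻¹)) * ((N : ℂ) * z ^ 2)⁻¹) = 0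
  ring

/-- **`E_h(w_N τ) - E_{w_N h}(τ)` is independent of `τ ∈ ℍ`** (`ℍ` is connected and the derivative vanishes).
[cite: Manin1972, Prop. 1.4] -/
theorem eichlerIntegral_fricke_sub_eq (h : CuspForm (Gamma0 N) 2) (τ τ' : ℍ) :
    eichlerIntegral h (glCast (frickeGL N : GL (Fin 2) ℚ) • τ) - eichlerIntegral (frickeInvolution N 2 h) τ =
      eichlerIntegral h (glCast (frickeGL N : GL (Fin 2) ℚ) • τ') -
        eichlerIntegral (frickeInvolution N 2 h) τ' := by
  set D : ℂ → ℂ := fun w ↦ eichlerIntegral h (ofComplex (-((N : ℂ) * w)⁻¹)) -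
      eichlerIntegral (frickeInvolution N 2 h) (ofComplex w)
  have hD : ∀ σ : ℍ, D σ = eichlerIntegral h (glCast (frickeGL N : GL (Fin 2) ℚ) • σ) -
      eichlerIntegral (frickeInvolution N 2 h) σ := by
    intro σ
    simp only [D]
    rw [← frickeGL_smul_ofComplex σ.im_pos, ofComplex_apply]
  rw [← hD, ← hD]
  exact isOpen_upperHalfPlaneSet.is_const_of_deriv_eq_zero (convex_halfSpace_im_gt 0).isPreconnected
    (fun w hw ↦ (hasDerivAt_eichlerIntegral_fricke_sub h hw).differentiableAt.differentiableWithinAt)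
    (fun w hw ↦ (hasDerivAt_eichlerIntegral_fricke_sub h hw).deriv) τ.im_pos τ'.im_pos

/-! ### Periods of `w_N h` are periods of `h` at the Fricke conjugate -/

/-- **`{∞, γ∞}_{w_N h} = {∞, γ'∞}_h` when `w_N γ = γ' w_N` on `ℍ`** (`γ, γ' ∈ Γ₀(N)`): the dual Fricke involution
maps the period functional of `γ` to that of its Fricke conjugate `γ' = w_N γ w_N⁻¹`. [cite: Merel1995Homologie, §2.3] -/
theorem cuspSymbol_frickeInvolution (h : CuspForm (Gamma0 N) 2) (γ γ' : Gamma0 N)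
    (hconj : ∀ τ : ℍ, glCast (frickeGL N : GL (Fin 2) ℚ) • ((γ : SL(2, ℤ)) • τ) =
      (γ' : SL(2, ℤ)) • (glCast (frickeGL N : GL (Fin 2) ℚ) • τ)) :
    cuspSymbol (frickeInvolution N 2 h) γ = cuspSymbol h γ' := by
  have E₁ := eichlerIntegral_smul_sub_holds (frickeInvolution N 2 h) γ UpperHalfPlane.I
  have E₂ := eichlerIntegral_smul_sub_holds h γ' (glCast (frickeGL N : GL (Fin 2) ℚ) • UpperHalfPlane.I)
  have hc := eichlerIntegral_fricke_sub_eq h ((γ : SL(2, ℤ)) • UpperHalfPlane.I) UpperHalfPlane.I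
  rw [hconj] at hc
  rw [← E₁, ← E₂]
  linear_combination -hc

/-- **The Fricke conjugate exists in `Γ₀(N)`**: for every `γ ∈ Γ₀(N)` there is `γ' ∈ Γ₀(N)` (namely
`w_N γ w_N⁻¹ = (d, -c/N; -Nb, a)`) with `w_N ∘ γ = γ' ∘ w_N` on `ℍ` (the tree's `frickeGL_mul_mul_inv_mem`:
`w_N` normalises `Γ₀(N)`). [cite: AtkinLehner1970, §2] -/
theorem exists_frickeConj_smul (γ : Gamma0 N) :
    ∃ γ' : Gamma0 N, ∀ τ : ℍ, glCast (frickeGL N : GL (Fin 2) ℚ) • ((γ : SL(2, ℤ)) • τ) =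
      (γ' : SL(2, ℤ)) • (glCast (frickeGL N : GL (Fin 2) ℚ) • τ) := by
  have hx : Matrix.SpecialLinearGroup.mapGL ℝ (γ : SL(2, ℤ)) ∈ (Gamma0 N : Subgroup (GL (Fin 2) ℝ)) :=
    Subgroup.mem_map_of_mem _ γ.2
  obtain ⟨δ, hδ, hδeq⟩ := Subgroup.mem_map.mp (frickeGL_mul_mul_inv_mem N hx)
  refine ⟨⟨δ, hδ⟩, fun τ ↦ ?_⟩
  have h1 : (δ : SL(2, ℤ)) • (glCast (frickeGL N : GL (Fin 2) ℚ) • τ) =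
      Matrix.SpecialLinearGroup.mapGL ℝ δ • (glCast (frickeGL N : GL (Fin 2) ℚ) • τ) := rfl
  have h2 : (γ : SL(2, ℤ)) • τ = Matrix.SpecialLinearGroup.mapGL ℝ (γ : SL(2, ℤ)) • τ := rfl
  change glCast (frickeGL N : GL (Fin 2) ℚ) • ((γ : SL(2, ℤ)) • τ) =
    (δ : SL(2, ℤ)) • (glCast (frickeGL N : GL (Fin 2) ℚ) • τ)
  rw [h1, h2, hδeq, ← mul_smul, ← mul_smul, inv_mul_cancel_right]

variable (N) in
/-- **The dual Fricke involution on period functionals**: `w_N^∨ {∞, γ∞} = {∞, γ'∞}` for the Fricke conjugate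
`γ'` of `γ` (`w_N ∘ γ = γ' ∘ w_N` on `ℍ`). [cite: Merel1995Homologie, §2.3] -/
theorem dualMap_frickeInvolution_periodFunctional (γ γ' : Gamma0 N)
    (hconj : ∀ τ : ℍ, glCast (frickeGL N : GL (Fin 2) ℚ) • ((γ : SL(2, ℤ)) • τ) =
      (γ' : SL(2, ℤ)) • (glCast (frickeGL N : GL (Fin 2) ℚ) • τ)) :
    (frickeInvolution N 2).dualMap (periodFunctional N γ) = periodFunctional N γ' := by
  ext h
  rw [LinearMap.dualMap_apply, periodFunctional_apply, periodFunctional_apply]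
  exact cuspSymbol_frickeInvolution h γ γ' hconj

variable (N) in
/-- **`w_N^∨` preserves the period homology `Λ = H₁(X₀(N), ℤ) ⊆ S₂(Γ₀(N))^∨`**: every element of `Λ` is a single
period functional `{∞, γ∞}` (`coe_periodHomology_eq_range`), and `w_N^∨ {∞, γ∞} = {∞, γ'∞} ∈ Λ`.
[cite: Merel1995Homologie, §2.3] -/
theorem dualMap_frickeInvolution_mem_periodHomology {φ : Module.Dual ℂ (CuspForm (Gamma0 N) 2)}
    (hφ : φ ∈ periodHomology N) : (frickeInvolution N 2).dualMap φ ∈ periodHomology N := by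
  have hφ' : φ ∈ (periodHomology N : Set (Module.Dual ℂ (CuspForm (Gamma0 N) 2))) := hφ
  rw [coe_periodHomology_eq_range] at hφ'
  obtain ⟨γ, rfl⟩ := hφ'
  obtain ⟨γ', hγ'⟩ := exists_frickeConj_smul γ
  rw [dualMap_frickeInvolution_periodFunctional N γ γ' hγ']
  exact periodFunctional_mem_periodHomology N γ'

variable (N) in
/-- **`w_N^∨ ∘ w_N^∨ = id` on `S₂(Γ₀(N))^∨`** (weight `2`: `w_N (w_N h) = (-1)² h = h`,
`frickeInvolution_frickeInvolution_holds`). [cite: AtkinLehner1970, Lemma 7] -/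
theorem dualMap_frickeInvolution_dualMap_frickeInvolution (φ : Module.Dual ℂ (CuspForm (Gamma0 N) 2)) :
    (frickeInvolution N 2).dualMap ((frickeInvolution N 2).dualMap φ) = φ := by
  ext h
  rw [LinearMap.dualMap_apply, LinearMap.dualMap_apply, frickeInvolution_frickeInvolution_holds N 2 h]
  norm_num

variable (N) in
/-- **`w_N^∨` is a bijection of `Λ` onto itself** (it preserves `Λ` and is an involution): every `x ∈ Λ` is
`w_N^∨ y` for a unique `y ∈ Λ`, namely `y = w_N^∨ x`. [cite: Merel1995Homologie, §2.3] -/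
theorem exists_unique_dualMap_frickeInvolution_eq {x : Module.Dual ℂ (CuspForm (Gamma0 N) 2)}
    (hx : x ∈ periodHomology N) :
    ∃! y : Module.Dual ℂ (CuspForm (Gamma0 N) 2), y ∈ periodHomology N ∧ (frickeInvolution N 2).dualMap y = x := by
  refine ⟨(frickeInvolution N 2).dualMap x,
    ⟨dualMap_frickeInvolution_mem_periodHomology N hx, dualMap_frickeInvolution_dualMap_frickeInvolution N x⟩,
    fun y hy ↦ ?_⟩
  rw [← hy.2, dualMap_frickeInvolution_dualMap_frickeInvolution]

variable (N) in
/-- **`w_N^∨` commutes with `T_n^∨` for `gcd(n, N) = 1`** on `S₂(Γ₀(N))^∨` (dual of the tree's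
`frickeInvolution_heckeT`: `w_N T_n = T_n w_N`), so on `Λ` the Fricke involution commutes with the Hecke
operators prime to the level — only the `U_q`, `q ∣ N`, are moved (to their transposes) by conjugation with
`w_N`. [cite: AtkinLehner1970, Lemma 11] -/
theorem dualMap_frickeInvolution_dualMap_heckeT (n : ℕ) [NeZero n] (hn : n.Coprime N)
    (φ : Module.Dual ℂ (CuspForm (Gamma0 N) 2)) :
    (frickeInvolution N 2).dualMap ((heckeT (Gamma0 N) 2 n).dualMap φ) =
      (heckeT (Gamma0 N) 2 n).dualMap ((frickeInvolution N 2).dualMap φ) := by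
  ext h
  simp only [LinearMap.dualMap_apply]
  rw [frickeInvolution_heckeT N 2 n hn h]

end Summit.BirchSwinnertonDyer.BirchSwinnertonDyer.Theorems.SdTorsion

end
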